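import Summits.ResolutionOfSingularities.ResolutionOfSingularities.Theorems.EquisingularLiftEquisingularLiftNatMultiOrdinaryPoints
import Summits.ResolutionOfSingularities.ResolutionOfSingularities.Theorems.EquisingularLiftEquisingularLiftNatSpecimenQuarticDerivations
import Summits.ResolutionOfSingularities.ResolutionOfSingularities.Theorems.EquisingularLiftEquisingularLiftNatLinAutTransport
import Literature.AlgebraicGeometry.Motives.ProjectiveSpaceDehomogenize
import Mathlib.RingTheory.Nullstellensatz
import Mathlib.RingTheory.MvPolynomial.EulerIdentity
import HarnessLib

/-!
# [OURS] EL♮ FOR HYPERSURFACES WITH ORDINARY MULTIPLE POINTS AT COORDINATE VERTICES — THE CLASSICAL JACOBIAN FORM OF T-MULTIORD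
# (cruxes `Theses.EquisingularLift.EquisingularLiftNat` / `…NatThree`, stmt-ResolutionOfSingularities-20038 / -20148; every dimension, every `p`)

[OURS · leafhand-res-equisingularlift-7 g1, 2026-08-31; cell `pub/decomp-res`] AI-produced, weaker than expert review; NOT a statement of any manuscript;
nothing here proves resolution of singularities in positive characteristic.  DEF-FREE helper (`--supports stmt-…-20038 --as helper`); no `sorry`; standard
axioms; ZERO named hypotheses.

Seat res-D-pv-013's T-MULTIORD ✓ `MultiOrd.elNatAt_ordinaryPoints` (…NatMultiOrdinaryPoints) concludes the route currency `ELNatAt p K (m+2) V₊(F) ι` for a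
prime form `F` whose marked vertices `P_c`, `c ∈ S`, are ordinary multiple points, under TWO RING-THEORETIC side hypotheses: (hsing) «every PRIME IDEAL of
`K[y]` containing `F(x_c := 1)` and all its partials contains every `y_j`» (`c ∈ S`) and (hoffS) «the chart rings `ChartRing F c`, `c ∉ S`, are regular
rings».  This file replaces both by the ONE hypothesis a geometer checks — the CLASSICAL JACOBIAN CONDITION ON CLOSED POINTS of `K^{m+3}`:

  (jac) every `a ≠ 0` with `F(a) = 0` and `∂F/∂x_i(a) = 0` for all `i` is a multiple of a marked vertex `e_c`, `c ∈ S`,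

i.e. «the singular points of `H = V₊(F)` are among the marked vertices» (`K` algebraically closed; Hilbert's Nullstellensatz, Mathlib
`MvPolynomial.IsPrime.vanishingIdeal_zeroLocus` / `isMaximal_iff_eq_vanishingIdeal_singleton`, and Stacks 07PF in the tree's form
✓ `SpecimenQuartic.isRegularRing_quotient_of_derivations`):

* `MultiOrd.isRegularRing_quotient_of_forall_exists_pderiv` — **affine Jacobian criterion, global form**: `K = K̄`, `f ∈ K[y₁,…,y_N]`; if at every zero of
  `f` some `∂f/∂y_j` does not vanish, `K[y]/(f)` is a regular ring;
* `MultiOrd.X_mem_of_forall_singular_eq_zero` — if the only common zero of `f, ∂f/∂y_j` is the origin, every prime `P ∋ f, ∂f/∂y_j` contains all `y_j`;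
* `MultiOrd.eval_insertNth_eq` / `eval_pderiv_insertNth_eq` / `eval_pderiv_self_insertNth_eq_zero` — chart dictionary at the closed point
  `a = (y₁,…,1_c,…,y_{m+2})`: `F(a) = F(x_c:=1)(y)`, `∂_{x_{c.succAbove j}}F(a) = ∂_{y_j}F(x_c:=1)(y)`, and — EULER — `∂_{x_c}F(a) = 0` too once these vanish;
* `MultiOrd.mem_and_eq_zero_of_jacobian` — under (jac): a singular point `y` of the chart `F(x_c := 1)` forces `c ∈ S` and `y = 0`;
* `MultiOrd.hsing_of_jacobian`, `MultiOrd.isRegularRing_chartRing_of_jacobian` — hence (hsing) for `c ∈ S` and (hoffS) for `c ∉ S`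
  (chart ring `≅ K[y]/(F(x_c:=1))`, ✓ `HypersurfaceSpecimen.exists_chartQuotEquiv`; `(F(x_c:=1))` radical for a prime form, ✓ `irreducible_or_isUnit_dehomogenize`);
* ★★ `MultiOrd.elNatAt_ordinaryPoints_of_jacobian` — **EL♮ (`ELNatAt`) for every prime form `F ∈ K[x₀,…,x_{m+2}]` (`K = K̄` of characteristic `p`, ANY `m`,
  ANY degree) whose vertex charts at the marked vertices `c ∈ S` read `Φ_c + Ψ_c` (`Φ_c` a NONSINGULAR form of degree `μ_c ≥ 1`, `Ψ_c ∈ (y)^{μ_c+1}`: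
  ORDINARY `μ_c`-fold points) and whose singular points (jac) are among the marked vertices** — witness `O = 𝕎(K)`, ONE blow-up of `ℙ^{m+2}_O` along the
  product of the `O`-points through the `P_c`;
* ★ `MultiOrd.elNatAt_of_range_eq_ordinaryPoints_of_jacobian` — the same for every binder `(H, ι)` of the crux with `range ι = V₊(F)` (✓ `LinAutTransport.elNatAt_of_range_eq`).

E.g. every nodal hypersurface (`μ_c = 2`, `Φ_c` a nonsingular quadratic form) with nodes at some coordinate vertices, in every dimension and characteristic;
with ✓ `QuadricELNat.elNatAt_of_elNatAt_linSubst` (PGL-transport) every hypersurface whose singular points are `≤ m+3` ordinary multiple points in linearly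
general position.  Honest label: closes no registered stub; the by-name stubs of 20038 / 20148 are untouched.

References: [Hartshorne1977, I Thm. 5.1, I Ex. 5.8, II Prop. 5.9]; [StacksProject, Tags 07PF, 080A, 0804]; [Matsumura1987, Thm. 14.2]; Hilbert's Nullstellensatz
(Mathlib `RingTheory/Nullstellensatz`); Euler's identity (Mathlib `IsHomogeneous.sum_X_mul_pderiv`).
-/

set_option linter.dupNamespace false -- mandated namespace `Summit.<Summit>.<Problem>` of this single-conjunct summit

noncomputable section

open CategoryTheory CategoryTheory.Limits AlgebraicGeometry TopologicalSpace
open MvPolynomial HomogeneousLocalization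
open Literature.AlgebraicGeometry.Resolution
open Literature.AlgebraicGeometry.Motives Literature.AlgebraicGeometry.Motives.SmoothHypersurface
open Literature.AlgebraicGeometry.Motives.ProjectiveSpace
open AlgebraicGeometry.Scheme.IdealSheafData
open Summit.ResolutionOfSingularities.ResolutionOfSingularities.Cruxes.EquisingularLift.StrataSplit

namespace Summit.ResolutionOfSingularities.ResolutionOfSingularities.Cruxes.EquisingularLiftNat.Sections

namespace MultiOrd

/-! ## Affine Jacobian criteria on closed points (`K` algebraically closed) -/

/-- **Affine Jacobian criterion, global form.**  `K = K̄`, `f ∈ K[y₁,…,y_N]`: if at every zero `x ∈ Kᴺ` of `f` some partial `∂f/∂y_j` does not vanish,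
then `K[y]/(f)` is a regular ring.  At a prime `Q ∋ f` choose a maximal ideal `𝔪_x ⊇ Q` (Nullstellensatz: `𝔪_x` is a point `x`); `f(x) = 0`, so some
`∂_j f ∉ 𝔪_x ⊇ Q`, and Stacks 07PF (✓ `SpecimenQuartic.isRegularRing_quotient_of_derivations`) applies with `D = ∂_j`.
[cite: StacksProject, Tag 07PF] [cite: Hartshorne1977, I Thm. 5.1] -/
theorem isRegularRing_quotient_of_forall_exists_pderiv (K : Type) [Field K] [IsAlgClosed K] {N : ℕ} (f : MvPolynomial (Fin N) K)
    (hz : ∀ x : Fin N → K, aeval x f = 0 → ∃ j, aeval x (pderiv j f) ≠ 0) :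
    IsRegularRing (MvPolynomial (Fin N) K ⧸ Ideal.span {f}) := by
  refine Summit.ResolutionOfSingularities.ResolutionOfSingularities.Theorems.EquisingularLift.SpecimenQuartic.isRegularRing_quotient_of_derivations
    (S₀ := K) f fun Q hQ hfQ => ?_
  by_contra hcon
  push Not at hcon
  obtain ⟨M, hM, hQM⟩ := Ideal.exists_le_maximal Q hQ.ne_top
  obtain ⟨x, hx⟩ := (MvPolynomial.isMaximal_iff_eq_vanishingIdeal_singleton (K := K)).mp hM
  have hev : ∀ r ∈ Q, aeval x r = 0 := fun r hr =>
    (MvPolynomial.mem_vanishingIdeal_singleton_iff x r).mp (hx ▸ hQM hr)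
  obtain ⟨j, hj⟩ := hz x (hev f hfQ)
  exact hj (hev _ (hcon (pderiv j)))

/-- **If the origin is the only common zero of `f` and its partials, every prime `P ∋ f, ∂f/∂y_j` contains all the variables** (`K = K̄`): `P` is the
vanishing ideal of its zero locus (Nullstellensatz for primes, Mathlib `IsPrime.vanishingIdeal_zeroLocus`), and that zero locus is `⊆ {0}`.
[cite: Hartshorne1977, I Thm. 1.3A] -/
theorem X_mem_of_forall_singular_eq_zero (K : Type) [Field K] [IsAlgClosed K] {N : ℕ} (f : MvPolynomial (Fin N) K)
    (hz : ∀ x : Fin N → K, aeval x f = 0 → (∀ j, aeval x (pderiv j f) = 0) → x = 0)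
    (P : Ideal (MvPolynomial (Fin N) K)) [P.IsPrime] (hf : f ∈ P) (hP : ∀ j, pderiv j f ∈ P) (j : Fin N) :
    (X j : MvPolynomial (Fin N) K) ∈ P := by
  rw [← MvPolynomial.IsPrime.vanishingIdeal_zeroLocus (K := K) P, MvPolynomial.mem_vanishingIdeal_iff]
  intro x hx
  rw [MvPolynomial.mem_zeroLocus_iff] at hx
  have hx0 : x = 0 := hz x (hx f hf) (fun j => hx _ (hP j))
  rw [hx0, aeval_X, Pi.zero_apply]

/-! ## The chart dictionary at a closed point of `D₊(x_c)` -/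

variable {K : Type} [Field K] {m : ℕ} (F : MvPolynomial (Fin (m + 2 + 1)) K) {d : ℕ}

/-- `F(y₁,…,1_c,…) = F(x_c := 1)(y)`. [folklore] -/
theorem eval_insertNth_eq (c : Fin (m + 2 + 1)) (y : Fin (m + 2) → K) :
    eval (Fin.insertNth c (1 : K) y) F = aeval y (ProjectiveSpace.dehomogenize K c F) := by
  have hy : (fun j => Fin.insertNth (α := fun _ => K) c 1 y (c.succAbove j)) = y := by
    funext j
    exact Fin.insertNth_apply_succAbove (α := fun _ => K) c 1 y j
  rw [show aeval y (ProjectiveSpace.dehomogenize K c F) = eval y (ProjectiveSpace.dehomogenize K c F) from rfl,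
    ← ProjectiveSpace.eval_dehomogenize c (Fin.insertNth c (1 : K) y) (Fin.insertNth_apply_same (α := fun _ => K) c 1 y) F, hy]

/-- `∂F/∂x_{c.succAbove j}(y₁,…,1_c,…) = ∂F(x_c := 1)/∂y_j (y)`. [folklore] -/
theorem eval_pderiv_insertNth_eq (c : Fin (m + 2 + 1)) (y : Fin (m + 2) → K) (j : Fin (m + 2)) :
    eval (Fin.insertNth c (1 : K) y) (pderiv (c.succAbove j) F) = aeval y (pderiv j (ProjectiveSpace.dehomogenize K c F)) := by
  rw [ProjectiveSpace.pderiv_dehomogenize, eval_insertNth_eq]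

variable (hF : F.IsHomogeneous d)
include hF

/-- **Euler**: if `F` is a form, `F(a) = 0` and all `∂F/∂x_{c.succAbove j}(a) = 0` at `a = (y₁,…,1_c,…)`, then also `∂F/∂x_c(a) = 0`
(`Σ_i a_i ∂_iF(a) = d·F(a)`, Mathlib `IsHomogeneous.sum_X_mul_pderiv`; `a_c = 1`). [folklore] -/
theorem eval_pderiv_self_insertNth_eq_zero (c : Fin (m + 2 + 1)) (y : Fin (m + 2) → K)
    (h0 : eval (Fin.insertNth c (1 : K) y) F = 0) (hj : ∀ j : Fin (m + 2), eval (Fin.insertNth c (1 : K) y) (pderiv (c.succAbove j) F) = 0) :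
    eval (Fin.insertNth c (1 : K) y) (pderiv c F) = 0 := by
  have heuler := congrArg (eval (Fin.insertNth c (1 : K) y)) hF.sum_X_mul_pderiv
  rw [map_nsmul, h0, smul_zero, map_sum, Fin.sum_univ_succAbove _ c] at heuler
  rw [Finset.sum_eq_zero (fun j _ => by rw [map_mul, hj j, mul_zero]), add_zero, map_mul, eval_X,
    Fin.insertNth_apply_same (α := fun _ => K), one_mul] at heuler
  exact heuler

/-- **All partials vanish at a chart-singular point**: with `a = (y₁,…,1_c,…)`, if `F(x_c:=1)(y) = 0` and all `∂_{y_j}F(x_c:=1)(y) = 0` then `F(a) = 0` and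
`∂F/∂x_i(a) = 0` for EVERY `i` (the `i = c` one by Euler). [folklore] -/
theorem eval_pderiv_insertNth_eq_zero (c : Fin (m + 2 + 1)) (y : Fin (m + 2) → K)
    (h0 : aeval y (ProjectiveSpace.dehomogenize K c F) = 0) (hj : ∀ j, aeval y (pderiv j (ProjectiveSpace.dehomogenize K c F)) = 0)
    (i : Fin (m + 2 + 1)) : eval (Fin.insertNth c (1 : K) y) (pderiv i F) = 0 := by
  have h0' : eval (Fin.insertNth c (1 : K) y) F = 0 := by rw [eval_insertNth_eq]; exact h0
  have hj' : ∀ j : Fin (m + 2), eval (Fin.insertNth c (1 : K) y) (pderiv (c.succAbove j) F) = 0 := fun j => by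
    rw [eval_pderiv_insertNth_eq]; exact hj j
  rcases Fin.eq_self_or_eq_succAbove c i with rfl | ⟨j, rfl⟩
  · exact eval_pderiv_self_insertNth_eq_zero F hF i y h0' hj'
  · exact hj' j

/-! ## From the classical Jacobian condition (jac) to the chart hypotheses of T-MULTIORD -/

variable (S : List (Fin (m + 2 + 1)))
  (hjac : ∀ a : Fin (m + 2 + 1) → K, a ≠ 0 → eval a F = 0 → (∀ i, eval a (pderiv i F) = 0) → ∃ c ∈ S, ∀ i, i ≠ c → a i = 0)
include hjac

/-- **Under (jac), a singular point `y` of the chart `F(x_c := 1)` forces `c ∈ S` and `y = 0`**: the point `a = (y₁,…,1_c,…) ≠ 0` has `F(a) = 0` and all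
partials `0` (Euler for `∂_c`), so `a ∈ K·e_{c'}` for some `c' ∈ S`; `a_c = 1` forces `c' = c`, and then `y_j = a_{c.succAbove j} = 0`. [folklore] -/
theorem mem_and_eq_zero_of_jacobian (c : Fin (m + 2 + 1)) (y : Fin (m + 2) → K)
    (h0 : aeval y (ProjectiveSpace.dehomogenize K c F) = 0) (hj : ∀ j, aeval y (pderiv j (ProjectiveSpace.dehomogenize K c F)) = 0) :
    c ∈ S ∧ y = 0 := by
  have ha : (Fin.insertNth c (1 : K) y : Fin (m + 2 + 1) → K) ≠ 0 := fun h => by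
    have h1 := congrFun h c
    rw [Fin.insertNth_apply_same (α := fun _ => K), Pi.zero_apply] at h1
    exact one_ne_zero h1
  have h0' : eval (Fin.insertNth c (1 : K) y) F = 0 := by rw [eval_insertNth_eq]; exact h0
  obtain ⟨c', hc'S, hc'⟩ := hjac _ ha h0' (eval_pderiv_insertNth_eq_zero F hF c y h0 hj)
  have hcc' : c' = c := by
    by_contra hne
    have h1 := hc' c (Ne.symm hne)
    rw [Fin.insertNth_apply_same (α := fun _ => K)] at h1
    exact one_ne_zero h1
  subst hcc'
  refine ⟨hc'S, funext fun j => ?_⟩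
  have h1 := hc' (c'.succAbove j) (Fin.succAbove_ne c' j)
  rwa [Fin.insertNth_apply_succAbove (α := fun _ => K)] at h1

/-- **(jac) ⇒ (hsing)**: for `c ∈ S` (indeed any `c`), every prime of `K[y]` containing `F(x_c := 1)` and its partials contains every `y_j` (`K = K̄`).
[cite: Hartshorne1977, I Thm. 1.3A] -/
theorem hsing_of_jacobian [IsAlgClosed K] (c : Fin (m + 2 + 1)) (P : Ideal (MvPolynomial (Fin (m + 2)) K)) (hPp : P.IsPrime)
    (hf : ProjectiveSpace.dehomogenize K c F ∈ P) (hP : ∀ j, pderiv j (ProjectiveSpace.dehomogenize K c F) ∈ P) (j : Fin (m + 2)) :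
    (X j : MvPolynomial (Fin (m + 2)) K) ∈ P :=
  X_mem_of_forall_singular_eq_zero K _ (fun y h0 hj => (mem_and_eq_zero_of_jacobian F hF S hjac c y h0 hj).2) P hf hP j

omit hjac in
/-- **The dehomogenisations of a prime form span radical ideals** (irreducible or a unit, ✓ `irreducible_or_isUnit_dehomogenize`).
[cite: Hartshorne1977, I §2, Ex. 2.10] -/
theorem radical_span_dehomogenize_eq_of_prime (hFp : Prime F) (c : Fin (m + 2 + 1)) :
    (Ideal.span {ProjectiveSpace.dehomogenize K c F}).radical = Ideal.span {ProjectiveSpace.dehomogenize K c F} := by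
  rcases ProjectiveSpace.irreducible_or_isUnit_dehomogenize (i := c) hF hFp.irreducible with hirr | hu
  · exact ((Ideal.span_singleton_prime hirr.ne_zero).mpr (UniqueFactorizationMonoid.irreducible_iff_prime.mp hirr)).radical
  · rw [Ideal.span_singleton_eq_top.mpr hu, Ideal.radical_top]

/-- **(jac) ⇒ (hoffS)**: for `c ∉ S` the chart ring `ChartRing F c ≅ K[y]/(F(x_c := 1))` is a regular ring — the chart has no singular closed point
(`mem_and_eq_zero_of_jacobian`), so the global affine Jacobian criterion applies. [cite: StacksProject, Tag 07PF] [cite: Hartshorne1977, I Thm. 5.1] -/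
theorem isRegularRing_chartRing_of_jacobian [IsAlgClosed K] (hFp : Prime F) (c : Fin (m + 2 + 1)) (hc : c ∉ S) :
    letI := MvPolynomial.gradedAlgebra (σ := Fin (m + 2 + 1)) (R := K)
    IsRegularRing (ChartRing F c hF) := by
  letI := MvPolynomial.gradedAlgebra (σ := Fin (m + 2 + 1)) (R := K)
  obtain ⟨θ, -⟩ := HypersurfaceSpecimen.exists_chartQuotEquiv F hF c _ rfl (radical_span_dehomogenize_eq_of_prime F hF hFp c)
  haveI : IsRegularRing (MvPolynomial (Fin (m + 2)) K ⧸ Ideal.span {ProjectiveSpace.dehomogenize K c F}) := by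
    refine isRegularRing_quotient_of_forall_exists_pderiv K _ fun y h0 => ?_
    by_contra hall
    push Not at hall
    exact hc (mem_and_eq_zero_of_jacobian F hF S hjac c y h0 hall).1
  exact IsRegularRing.of_ringEquiv θ.symm

/-! ## ★★ EL♮ under the classical Jacobian condition -/

/-- ★★ **EL♮ HOLDS FOR EVERY HYPERSURFACE WHOSE SINGULAR POINTS ARE ORDINARY MULTIPLE POINTS AT COORDINATE VERTICES — classical Jacobian form, every
dimension, every characteristic.**  `K` algebraically closed of characteristic `p`; `F ∈ K[x₀,…,x_{m+2}]` a prime form; `S` a duplicate-free list of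
coordinates; (ord) for `c ∈ S` the vertex chart is `F(x_c := 1) = Φ + Ψ`, `Φ` a NONSINGULAR form of degree `μ ≥ 1`, `Ψ ∈ (y)^{μ+1}` (`P_c` an ordinary
`μ`-fold point); (jac) every `a ≠ 0` in `K^{m+3}` with `F(a) = 0` and `∇F(a) = 0` is a multiple of some `e_c`, `c ∈ S`.  Then
`Theorems.EquisingularLift.ELNatAt p K (m+2) V₊(F) ι` (✓ `MultiOrd.elNatAt_ordinaryPoints` with (hsing)/(hoffS) supplied by `hsing_of_jacobian` /
`isRegularRing_chartRing_of_jacobian`): `O = 𝕎(K)`, ONE blow-up of `ℙ^{m+2}_O` along the product of the `O`-points through the `P_c`.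
[OURS · L1 W4.5b] [cite: Hartshorne1977, I Thm. 5.1] [cite: StacksProject, Tag 080A] -/
theorem elNatAt_ordinaryPoints_of_jacobian (p : ℕ) (hp : p.Prime) [CharP K p] [IsAlgClosed K] (hFp : Prime F) (hS : S.Nodup)
    (hord : ∀ c ∈ S, ∃ (μ : ℕ) (Φ Ψ : MvPolynomial (Fin (m + 2)) K), 1 ≤ μ ∧ Φ.IsHomogeneous μ ∧ IsNonsingularForm K Φ ∧
      Ψ ∈ Ideal.span (Set.range (X : Fin (m + 2) → MvPolynomial (Fin (m + 2)) K)) ^ (μ + 1) ∧ ProjectiveSpace.dehomogenize K c F = Φ + Ψ) :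
    letI := MvPolynomial.gradedAlgebra (σ := Fin (m + 2 + 1)) (R := K)
    Theorems.EquisingularLift.ELNatAt p K (m + 2) (hypersurface F).left (hypersurfaceι F).left :=
  letI := MvPolynomial.gradedAlgebra (σ := Fin (m + 2 + 1)) (R := K)
  MultiOrd.elNatAt_ordinaryPoints p hp K F hF hFp S hS hord (fun c _ P hP hf hPj j => hsing_of_jacobian F hF S hjac c P hP hf hPj j)
    (fun c hc => isRegularRing_chartRing_of_jacobian F hF S hjac hFp c hc)

/-- ★ **The same for every binder `(H, ι)` of the crux with `range ι = V₊(F)`** (`ELNatAt` depends on `(H, ι)` only through `range ι`,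
✓ `LinAutTransport.elNatAt_of_range_eq`; `range (hypersurfaceι F) = V₊(F)`, ✓ `range_hypersurfaceι`). [OURS · L1 W4.5b] [cite: Hartshorne1977, I Thm. 5.1] -/
theorem elNatAt_of_range_eq_ordinaryPoints_of_jacobian (p : ℕ) (hp : p.Prime) [CharP K p] [IsAlgClosed K] (hFp : Prime F) (hS : S.Nodup)
    (hord : ∀ c ∈ S, ∃ (μ : ℕ) (Φ Ψ : MvPolynomial (Fin (m + 2)) K), 1 ≤ μ ∧ Φ.IsHomogeneous μ ∧ IsNonsingularForm K Φ ∧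
      Ψ ∈ Ideal.span (Set.range (X : Fin (m + 2) → MvPolynomial (Fin (m + 2)) K)) ^ (μ + 1) ∧ ProjectiveSpace.dehomogenize K c F = Φ + Ψ)
    {H : Scheme.{0}} (ι : H ⟶ (projectiveSpace (m + 2) K).left)
    (hrange : letI := MvPolynomial.gradedAlgebra (σ := Fin (m + 2 + 1)) (R := K)
      Set.range ι = {x : Proj (homogeneousSubmodule (Fin (m + 2 + 1)) K) | F ∈ x.asHomogeneousIdeal}) :
    Theorems.EquisingularLift.ELNatAt p K (m + 2) H ι := by
  letI := MvPolynomial.gradedAlgebra (σ := Fin (m + 2 + 1)) (R := K)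
  refine LinAutTransport.elNatAt_of_range_eq p K (m + 2) ι (hypersurfaceι F).left ?_
    (elNatAt_ordinaryPoints_of_jacobian F hF S hjac p hp hFp hS hord)
  rw [hrange, range_hypersurfaceι]
  ext x
  refine ⟨fun h => (ProjectiveSpectrum.mem_zeroLocus _ _ _).mpr (Set.singleton_subset_iff.mpr h), fun h => ?_⟩
  have h' : F ∈ (x.asHomogeneousIdeal : Set (MvPolynomial (Fin (m + 2 + 1)) K)) :=
    Set.singleton_subset_iff.mp ((ProjectiveSpectrum.mem_zeroLocus _ _ _).mp h)
  exact h'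

end MultiOrd

end Summit.ResolutionOfSingularities.ResolutionOfSingularities.Cruxes.EquisingularLiftNat.Sections

end
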